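import Summits.KontsevichZagierPeriods.KontsevichZagierPeriods.Theorems.TerasomaMultiplicationMultiplicationAccessibleCornerGraphSpelling

/-!
# `MultiplicationAccessible` (stmt-KontsevichZagierPeriods-12305), line `shifted-family-prime-sieve`:
the corner Stokes graph package, II — the `v`-derivative of `c₃`

For the Liouville rotation flow at `p = 3` (corner Stokes on `W = U × (0,1)_v`), the fourth
component of the closed `3`-form is
`c₃ = −(1/3)·v^(3x)·(1 − vZ)^(3s−1)·H^(3s−1)·K·(M₀/t₀ + M₁/t₁ + M₂/t₂)`. Only the `v`-slot moves
under `a ↦ c₃(update w 3 a)`; by the division spelling (`cornerGraphSpelling`: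
`G(t)y² = (1/3)y^(3s−1)K·ΣM/t`, `y = H(1 − Z)`) the constant factor is
`G(t(w))y²/(1 − Z)^(3s−1)`, so `−c₃` is the primitive `v^(3x)((1 − vZ)/(1 − Z))^(3s−1)·G(t)y²`
of the landed `v`-move `cornerStokesV`, and `∂_v c₃` is minus its integrand
(`cornerGraphDeriv`, registered sub-goal). References: Kontsevich–Zagier 2001 §1.2 rule (3).
-/

noncomputable section

open MeasureTheory Set Real
open scoped BigOperators

namespace Summit.KontsevichZagierPeriods.TerasomaMultiplication.MultiplicationAccessible

namespace CornerGraph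

/-- On `W` the geometric mean `Z w = (t₀t₁t₂)^(1/3)` lies in `(0,1)`. [folklore] -/
theorem zetaW_mem {Z : (Fin 4 → ℝ) → ℝ}
    (hZ : ∀ w, Z w = ((1 - w 2 * (1 - w 0 - w 1)) * (1 - w 2 * w 0) * (1 - w 2 * w 1)) ^ ((1:ℝ)/3))
    {w : Fin 4 → ℝ} (h0 : 0 < w 0) (h1 : 0 < w 1) (h01 : w 0 + w 1 < 1) (hy : 0 < w 2)
    (ha : w 2 * (1 - w 0 - w 1) < 1) (hb : w 2 * w 0 < 1) (hc : w 2 * w 1 < 1) :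
    0 < Z w ∧ Z w < 1 := by
  obtain ⟨⟨ht0, ht0'⟩, ⟨ht1, ht1'⟩, ⟨ht2, ht2'⟩⟩ := t_mem h0 h1 h01 hy ha hb hc
  have hp : 0 < (1 - w 2 * (1 - w 0 - w 1)) * (1 - w 2 * w 0) * (1 - w 2 * w 1) := by positivity
  have hl : (1 - w 2 * (1 - w 0 - w 1)) * (1 - w 2 * w 0) * (1 - w 2 * w 1) < 1 := by
    calc (1 - w 2 * (1 - w 0 - w 1)) * (1 - w 2 * w 0) * (1 - w 2 * w 1) < 1 * 1 * 1 := by gcongr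
      _ = 1 := by ring
  rw [hZ]
  exact ⟨rpow_pos_of_pos hp _, rpow_lt_one hp.le hl (by norm_num)⟩

/-- `t^(p) = t^(p−1) · t` for `t ≠ 0` (splitting off one power). [folklore] -/
theorem rpow_eq_rpow_sub_one_mul {t : ℝ} (ht : t ≠ 0) (p : ℝ) : t ^ p = t ^ (p - 1) * t := by
  rw [← rpow_add_one ht, sub_add_cancel]

end CornerGraph

/-- **The `v`-derivative of `c₃`** (registered sub-goal `cornerGraphDeriv` of `stub_gmThreeShifted`):
on `W`, `a ↦ c₃(update w 3 a) = −(1/3)H^(3s−1)K(ΣM/t)·a^(3x)(1 − aZ)^(3s−1)` (only the `v`-slot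
moves), and since `(1/3)H^(3s−1)K·ΣM/t = G(t(w))y²/(1 − Z)^(3s−1)` (division spelling,
`y = H(1 − Z)`), its derivative at `v = w 3` is
`−(3x v^(3x−1)ρ^(3s−1) − (3s−1)v^(3x)Zρ^(3s−2)/(1 − Z))·G(t(w))y²`, `ρ = (1 − vZ)/(1 − Z)`.
[cite: KontsevichZagier2001, §1.2 rule (3)] -/
theorem cornerGraphDeriv : ∀ (x s : ℚ), 2 ≤ x → 3 ≤ s → ∀ (Z S H K M0 M1 M2 P : (Fin 4 → ℝ) → ℝ),
    (∀ w, Z w = ((1 - w 2 * (1 - w 0 - w 1)) * (1 - w 2 * w 0) * (1 - w 2 * w 1)) ^ ((1:ℝ)/3)) →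
    (∀ w, S w = 1 - w 2 * ((1 - w 0 - w 1) * w 0 + (1 - w 0 - w 1) * w 1 + w 0 * w 1) +
      (w 2) ^ 2 * ((1 - w 0 - w 1) * w 0 * w 1)) →
    (∀ w, H w = (1 + Z w + Z w ^ 2) / S w) →
    (∀ w, K w = ((1 - w 0 - w 1) * w 0 * w 1) ^ ((s:ℝ) - 1)) →
    (∀ w, M0 w = (1 - w 2 * (1 - w 0 - w 1)) ^ (x:ℝ) * (1 - w 2 * w 0) ^ ((x:ℝ) - 2/3) * (1 - w 2 * w 1) ^ ((x:ℝ) - 1/3)) →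
    (∀ w, M1 w = (1 - w 2 * (1 - w 0 - w 1)) ^ ((x:ℝ) - 1/3) * (1 - w 2 * w 0) ^ (x:ℝ) * (1 - w 2 * w 1) ^ ((x:ℝ) - 2/3)) →
    (∀ w, M2 w = (1 - w 2 * (1 - w 0 - w 1)) ^ ((x:ℝ) - 2/3) * (1 - w 2 * w 0) ^ ((x:ℝ) - 1/3) * (1 - w 2 * w 1) ^ (x:ℝ)) →
    (∀ w, P w = (w 3) ^ (3 * (x:ℝ) - 1) * (1 - w 3 * Z w) ^ (3 * (s:ℝ) - 1) * H w ^ (3 * (s:ℝ)) * K w) →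
    ∀ (G : (Fin 3 → ℝ) → ℝ), (∀ t : Fin 3 → ℝ, G t = (1 + t 0 / (t 0 * t 1 * t 2) ^ ((1:ℝ)/3) +
      t 0 * t 1 / ((t 0 * t 1 * t 2) ^ ((1:ℝ)/3)) ^ 2) / 3 *
      ∏ k : Fin 3, (t k) ^ ((x:ℝ) + ((k:ℕ):ℝ) / 3 - 1) * (1 - t k) ^ ((s:ℝ) - 1)) →
    ∀ (c3 : (Fin 4 → ℝ) → ℝ), (∀ w, c3 w = -(1/3 * (w 3) ^ (3 * (x:ℝ)) * (1 - w 3 * Z w) ^ (3 * (s:ℝ) - 1) * H w ^ (3 * (s:ℝ) - 1) *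
      K w * (M0 w / (1 - w 2 * (1 - w 0 - w 1)) + M1 w / (1 - w 2 * w 0) + M2 w / (1 - w 2 * w 1)))) →
    ∀ w ∈ {w : Fin 4 → ℝ | 0 < w 0 ∧ 0 < w 1 ∧ w 0 + w 1 < 1 ∧ 0 < w 2 ∧ w 2 * (1 - w 0 - w 1) < 1 ∧ w 2 * w 0 < 1 ∧ w 2 * w 1 < 1 ∧ 0 < w 3 ∧ w 3 < 1},
      HasDerivAt (fun a => c3 (Function.update w 3 a))
        (-((3 * (x:ℝ) * (w 3) ^ (3 * (x:ℝ) - 1) * ((1 - w 3 * Z w) / (1 - Z w)) ^ (3 * (s:ℝ) - 1) -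
          (3 * (s:ℝ) - 1) * (w 3) ^ (3 * (x:ℝ)) * Z w * ((1 - w 3 * Z w) / (1 - Z w)) ^ (3 * (s:ℝ) - 2) /
            (1 - Z w)) * (G ![1 - w 2 * (1 - w 0 - w 1), 1 - w 2 * w 0, 1 - w 2 * w 1] * (w 2) ^ 2))) (w 3) := by
  intro x s hx hs Z S H K M0 M1 M2 P hZ hS hH hK hM0 hM1 hM2 hP G hG c3 hc3 w hw
  obtain ⟨hGD, hHy⟩ :=
    cornerGraphSpelling x s hx hs Z S H K M0 M1 M2 P hZ hS hH hK hM0 hM1 hM2 hP G hG w hw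
  obtain ⟨h0, h1, h01, hy, ha, hb, hc, hv0, hv1⟩ := hw
  obtain ⟨hz0, hz1⟩ := CornerGraph.zetaW_mem hZ h0 h1 h01 hy ha hb hc
  have h1z : 0 < 1 - Z w := by linarith
  have hvz : 0 < 1 - w 3 * Z w := by nlinarith
  have hHpos : 0 < H w := pos_of_mul_pos_left (by rw [hHy]; exact hy) h1z.le
  -- `y^(3s-1) = H^(3s-1) (1 - Z)^(3s-1)`
  have hyP : (w 2) ^ (3 * (s:ℝ) - 1) = H w ^ (3 * (s:ℝ) - 1) * (1 - Z w) ^ (3 * (s:ℝ) - 1) := by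
    rw [← mul_rpow hHpos.le h1z.le, hHy]
  -- only the `v`-slot moves
  have u0 : ∀ a, Function.update w 3 a 0 = w 0 := fun a => Function.update_of_ne (by decide) a w
  have u1 : ∀ a, Function.update w 3 a 1 = w 1 := fun a => Function.update_of_ne (by decide) a w
  have u2 : ∀ a, Function.update w 3 a 2 = w 2 := fun a => Function.update_of_ne (by decide) a w
  have u3 : ∀ a, Function.update w 3 a 3 = a := fun a => Function.update_self 3 a w
  have hfun : (fun a => c3 (Function.update w 3 a)) = fun a => -(1/3 * a ^ (3 * (x:ℝ)) *
      (1 - a * Z w) ^ (3 * (s:ℝ) - 1) * H w ^ (3 * (s:ℝ) - 1) * K w *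
      (M0 w / (1 - w 2 * (1 - w 0 - w 1)) + M1 w / (1 - w 2 * w 0) + M2 w / (1 - w 2 * w 1))) := by
    funext a
    simp only [hc3, hH, hZ, hS, hK, hM0, hM1, hM2, u0, u1, u2, u3]
  rw [hfun, hGD, hyP]
  -- atoms
  set v := w 3
  set z := Z w
  set Hp := H w ^ (3 * (s:ℝ) - 1)
  set Kw := K w
  set Sg := M0 w / (1 - w 2 * (1 - w 0 - w 1)) + M1 w / (1 - w 2 * w 0) + M2 w / (1 - w 2 * w 1)
  -- the one-variable derivative of `a ↦ -(1/3 a^(3x) (1 - a z)^(3s-1) Hp Kw Sg)`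
  have d1 : HasDerivAt (fun a : ℝ => a ^ (3 * (x:ℝ))) (3 * (x:ℝ) * v ^ (3 * (x:ℝ) - 1)) v := by
    simpa using (hasDerivAt_id v).rpow_const (p := 3 * (x:ℝ)) (Or.inl hv0.ne')
  have d2 : HasDerivAt (fun a : ℝ => (1 - a * z) ^ (3 * (s:ℝ) - 1))
      (-(1 * z) * (3 * (s:ℝ) - 1) * (1 - v * z) ^ (3 * (s:ℝ) - 1 - 1)) v :=
    (((hasDerivAt_id v).mul_const z).const_sub 1).rpow_const (Or.inl hvz.ne')
  have d := (((((d1.const_mul (1/3 : ℝ)).mul d2).mul_const Hp).mul_const Kw).mul_const Sg).neg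
  refine d.congr_deriv ?_
  -- the identity of the two spellings of the derivative
  rw [show (3:ℝ) * s - 1 - 1 = 3 * s - 2 by ring, div_rpow hvz.le h1z.le (3 * (s:ℝ) - 1),
    div_rpow hvz.le h1z.le (3 * (s:ℝ) - 2), CornerGraph.rpow_eq_rpow_sub_one_mul hvz.ne' (3 * (s:ℝ) - 1),
    CornerGraph.rpow_eq_rpow_sub_one_mul h1z.ne' (3 * (s:ℝ) - 1),
    CornerGraph.rpow_eq_rpow_sub_one_mul hv0.ne' (3 * (x:ℝ)), show (3:ℝ) * s - 1 - 1 = 3 * s - 2 by ring]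
  set p1 := v ^ (3 * (x:ℝ) - 1)
  set p2 := (1 - v * z) ^ (3 * (s:ℝ) - 2)
  set p3 := (1 - z) ^ (3 * (s:ℝ) - 2)
  set omz := 1 - z
  have homz0 : omz ≠ 0 := h1z.ne'
  have hp30 : p3 ≠ 0 := (rpow_pos_of_pos h1z _).ne'
  field_simp
  ring

end Summit.KontsevichZagierPeriods.TerasomaMultiplication.MultiplicationAccessible

end
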